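import Summits.Ventures.Crystal3D.StickySpheres.SevenCensusPatterns
import Summits.Ventures.Crystal3D.StickySpheres.ContactGraph
import HarnessLib

/-!
# The pentagonal bipyramid is realised: the fifth seven-ball contact graph

Venture `Crystal3D` (cell `pub-crystal3d`, seat p2). Companion of `SevenWitnesses.lean` (integer models for `tricap`, `capoct`,
`axial`, `helix`) and `SevenCensus.lean`: the remaining good pattern `bipyr` (pentagonal bipyramid: a closed ring of five
balls each touching two apex balls, apices NOT touching) is the contact graph of an explicit packing of seven unit-diameter
balls with exactly fifteen contacts. Its Gram matrix involves `√5`, so there is no integer model; the witness uses the cell's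
exact STEP-0 coordinates of cluster `n7-0001` in `ℚ(√3, √5)` (`step0/clusters-n7.jsonl`), and every one of the `21` squared
distances is verified as a polynomial identity in `√3, √5` (`linear_combination` with `(√3)² = 3`, `(√5)² = 5`): the fifteen
contacts have squared distance `1`, five non-adjacent ring pairs `(3 + √5)/2`, and the two apices `2 − (2/5)√5 > 1`.
With `SevenCensus.seven_census` and `SevenWitnesses.lean` this completes the seven-ball census at graph level: the contact
graphs of fifteen-contact packings of seven balls are EXACTLY the five graphs, up to relabelling.

HONEST FRAMING: one explicit packing, kernel-checked algebra; nothing about crystallization.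
-/

noncomputable section

namespace Summit.Ventures.Crystal3D

open SevenSearch SevenCensus

/-- A point of `ℝ³` from its three coordinates. [folklore] -/
def realVec (v : Fin 3 → ℝ) : EuclideanSpace ℝ (Fin 3) := WithLp.toLp 2 v

/-- Coordinates of `realVec`. [folklore] -/
@[simp] theorem realVec_apply (v : Fin 3 → ℝ) (i : Fin 3) : realVec v i = v i := rfl

/-- Squared distance between two coordinate points. [folklore] -/
theorem dist_realVec_sq (v w : Fin 3 → ℝ) :
    dist (realVec v) (realVec w) ^ 2 = (v 0 - w 0) ^ 2 + (v 1 - w 1) ^ 2 + (v 2 - w 2) ^ 2 := by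
  rw [EuclideanSpace.dist_eq, Real.sq_sqrt (Finset.sum_nonneg fun i _ => sq_nonneg _), Fin.sum_univ_three]
  simp only [realVec_apply, Real.dist_eq, sq_abs]

/-- The pentagonal-bipyramid coordinates of cluster `n7-0001` as polynomials in `a = √3`, `b = √5` (`√15 = ab`): ring
`0, 2, 4, 1, 3` (labels), apices `5, 6`. [folklore] -/
def bipyrCoord (a b : ℝ) : Fin 7 → Fin 3 → ℝ :=
  ![![0, 0, 0], ![1 / 2, a / 3 + a * b / 6, -(a / 6) - a * b / 6], ![1, 0, 0],
    ![1 / 4 - b / 4, a / 4 + a * b / 12, -(a / 3)], ![3 / 4 + b / 4, a / 4 + a * b / 12, -(a / 3)], ![1 / 2, a / 2, 0],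
    ![1 / 2, -(a / 6) + 2 * a * b / 15, -(a / 3) - a * b / 15]]

/-- The pentagonal bipyramid configuration. [folklore] -/
def bipyrConfig : Fin 7 → EuclideanSpace ℝ (Fin 3) := fun i => realVec (bipyrCoord (Real.sqrt 3) (Real.sqrt 5) i)

/-- **`bipyr` is realised** with exactly its fifteen contacts (and all other pairs strictly farther than `1`). [folklore] -/
theorem bipyr_realised : ∃ x : Fin 7 → EuclideanSpace ℝ (Fin 3), IsUnitPacking x ∧ numContacts x = 15 ∧
    ∀ a b : Fin 7, a ≠ b → (dist (x a) (x b) = 1 ↔ (maskOf (bipyrEdges (0, 1, 2, 3, 4, 5, 6))).testBit (pidx a b) = true) := by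
  classical
  have h3 : Real.sqrt 3 ^ 2 = 3 := Real.sq_sqrt (by norm_num)
  have h5 : Real.sqrt 5 ^ 2 = 5 := Real.sq_sqrt (by norm_num)
  have h5n : 0 ≤ Real.sqrt 5 := Real.sqrt_nonneg 5
  have h5lt : Real.sqrt 5 < 5 / 2 := (Real.sqrt_lt' (by norm_num)).2 (by norm_num)
  have hsq : ∀ i j : Fin 7, dist (bipyrConfig i) (bipyrConfig j) ^ 2 =
      (bipyrCoord (Real.sqrt 3) (Real.sqrt 5) i 0 - bipyrCoord (Real.sqrt 3) (Real.sqrt 5) j 0) ^ 2 +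
      (bipyrCoord (Real.sqrt 3) (Real.sqrt 5) i 1 - bipyrCoord (Real.sqrt 3) (Real.sqrt 5) j 1) ^ 2 +
      (bipyrCoord (Real.sqrt 3) (Real.sqrt 5) i 2 - bipyrCoord (Real.sqrt 3) (Real.sqrt 5) j 2) ^ 2 :=
    fun i j => dist_realVec_sq _ _
  have q01 : dist (bipyrConfig 0) (bipyrConfig 1) ^ 2 = (3 / 2 : ℝ) + (1 / 2 : ℝ) * Real.sqrt 5 := by
    rw [hsq]
    simp only [bipyrCoord, Matrix.cons_val_zero, Matrix.cons_val_one, Matrix.cons_val_two, Matrix.head_cons, Matrix.tail_cons]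
    linear_combination ((5 / 36 : ℝ) + (1 / 6 : ℝ) * Real.sqrt 5 + (1 / 18 : ℝ) * Real.sqrt 5 * Real.sqrt 5) * h3 + ((1 / 6 : ℝ)) * h5
  have q02 : dist (bipyrConfig 0) (bipyrConfig 2) ^ 2 = 1 := by
    rw [hsq]
    simp only [bipyrCoord, Matrix.cons_val_zero, Matrix.cons_val_one, Matrix.cons_val_two, Matrix.head_cons, Matrix.tail_cons]
    linear_combination ((0 : ℝ)) * h3 + ((0 : ℝ)) * h5
  have q03 : dist (bipyrConfig 0) (bipyrConfig 3) ^ 2 = 1 := by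
    rw [hsq]
    simp only [bipyrCoord, Matrix.cons_val_zero, Matrix.cons_val_one, Matrix.cons_val_two, Matrix.cons_val,
      Matrix.head_cons, Matrix.tail_cons]
    linear_combination ((25 / 144 : ℝ) + (1 / 24 : ℝ) * Real.sqrt 5 + (1 / 144 : ℝ) * Real.sqrt 5 * Real.sqrt 5) * h3 + ((1 / 12 : ℝ)) * h5
  have q04 : dist (bipyrConfig 0) (bipyrConfig 4) ^ 2 = (3 / 2 : ℝ) + (1 / 2 : ℝ) * Real.sqrt 5 := by
    rw [hsq]
    simp only [bipyrCoord, Matrix.cons_val_zero, Matrix.cons_val_one, Matrix.cons_val_two, Matrix.cons_val,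
      Matrix.head_cons, Matrix.tail_cons]
    linear_combination ((25 / 144 : ℝ) + (1 / 24 : ℝ) * Real.sqrt 5 + (1 / 144 : ℝ) * Real.sqrt 5 * Real.sqrt 5) * h3 + ((1 / 12 : ℝ)) * h5
  have q05 : dist (bipyrConfig 0) (bipyrConfig 5) ^ 2 = 1 := by
    rw [hsq]
    simp only [bipyrCoord, Matrix.cons_val_zero, Matrix.cons_val_one, Matrix.cons_val_two, Matrix.cons_val,
      Matrix.head_cons, Matrix.tail_cons]
    linear_combination ((1 / 4 : ℝ)) * h3 + ((0 : ℝ)) * h5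
  have q06 : dist (bipyrConfig 0) (bipyrConfig 6) ^ 2 = 1 := by
    rw [hsq]
    simp only [bipyrCoord, Matrix.cons_val_zero, Matrix.cons_val_one, Matrix.cons_val_two, Matrix.cons_val,
      Matrix.head_cons, Matrix.tail_cons]
    linear_combination ((5 / 36 : ℝ) + (1 / 45 : ℝ) * Real.sqrt 5 * Real.sqrt 5) * h3 + ((1 / 15 : ℝ)) * h5
  have q12 : dist (bipyrConfig 1) (bipyrConfig 2) ^ 2 = (3 / 2 : ℝ) + (1 / 2 : ℝ) * Real.sqrt 5 := by
    rw [hsq]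
    simp only [bipyrCoord, Matrix.cons_val_zero, Matrix.cons_val_one, Matrix.cons_val_two, Matrix.head_cons, Matrix.tail_cons]
    linear_combination ((5 / 36 : ℝ) + (1 / 6 : ℝ) * Real.sqrt 5 + (1 / 18 : ℝ) * Real.sqrt 5 * Real.sqrt 5) * h3 + ((1 / 6 : ℝ)) * h5
  have q13 : dist (bipyrConfig 1) (bipyrConfig 3) ^ 2 = 1 := by
    rw [hsq]
    simp only [bipyrCoord, Matrix.cons_val_zero, Matrix.cons_val_one, Matrix.cons_val_two, Matrix.cons_val,
      Matrix.head_cons, Matrix.tail_cons]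
    linear_combination ((5 / 144 : ℝ) + (-1 / 24 : ℝ) * Real.sqrt 5 + (5 / 144 : ℝ) * Real.sqrt 5 * Real.sqrt 5) * h3 + ((1 / 6 : ℝ)) * h5
  have q14 : dist (bipyrConfig 1) (bipyrConfig 4) ^ 2 = 1 := by
    rw [hsq]
    simp only [bipyrCoord, Matrix.cons_val_zero, Matrix.cons_val_one, Matrix.cons_val_two, Matrix.cons_val,
      Matrix.head_cons, Matrix.tail_cons]
    linear_combination ((5 / 144 : ℝ) + (-1 / 24 : ℝ) * Real.sqrt 5 + (5 / 144 : ℝ) * Real.sqrt 5 * Real.sqrt 5) * h3 + ((1 / 6 : ℝ)) * h5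
  have q15 : dist (bipyrConfig 1) (bipyrConfig 5) ^ 2 = 1 := by
    rw [hsq]
    simp only [bipyrCoord, Matrix.cons_val_zero, Matrix.cons_val_one, Matrix.cons_val_two, Matrix.cons_val,
      Matrix.head_cons, Matrix.tail_cons]
    linear_combination ((1 / 18 : ℝ) + (1 / 18 : ℝ) * Real.sqrt 5 * Real.sqrt 5) * h3 + ((1 / 6 : ℝ)) * h5
  have q16 : dist (bipyrConfig 1) (bipyrConfig 6) ^ 2 = 1 := by
    rw [hsq]
    simp only [bipyrCoord, Matrix.cons_val_zero, Matrix.cons_val_one, Matrix.cons_val_two, Matrix.cons_val,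
      Matrix.head_cons, Matrix.tail_cons]
    linear_combination ((5 / 18 : ℝ) + (1 / 90 : ℝ) * Real.sqrt 5 * Real.sqrt 5) * h3 + ((1 / 30 : ℝ)) * h5
  have q23 : dist (bipyrConfig 2) (bipyrConfig 3) ^ 2 = (3 / 2 : ℝ) + (1 / 2 : ℝ) * Real.sqrt 5 := by
    rw [hsq]
    simp only [bipyrCoord, Matrix.cons_val_zero, Matrix.cons_val_one, Matrix.cons_val_two, Matrix.cons_val,
      Matrix.head_cons, Matrix.tail_cons]
    linear_combination ((25 / 144 : ℝ) + (1 / 24 : ℝ) * Real.sqrt 5 + (1 / 144 : ℝ) * Real.sqrt 5 * Real.sqrt 5) * h3 + ((1 / 12 : ℝ)) * h5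
  have q24 : dist (bipyrConfig 2) (bipyrConfig 4) ^ 2 = 1 := by
    rw [hsq]
    simp only [bipyrCoord, Matrix.cons_val_zero, Matrix.cons_val_one, Matrix.cons_val_two, Matrix.cons_val,
      Matrix.head_cons, Matrix.tail_cons]
    linear_combination ((25 / 144 : ℝ) + (1 / 24 : ℝ) * Real.sqrt 5 + (1 / 144 : ℝ) * Real.sqrt 5 * Real.sqrt 5) * h3 + ((1 / 12 : ℝ)) * h5
  have q25 : dist (bipyrConfig 2) (bipyrConfig 5) ^ 2 = 1 := by
    rw [hsq]
    simp only [bipyrCoord, Matrix.cons_val_zero, Matrix.cons_val_one, Matrix.cons_val_two, Matrix.cons_val,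
      Matrix.head_cons, Matrix.tail_cons]
    linear_combination ((1 / 4 : ℝ)) * h3 + ((0 : ℝ)) * h5
  have q26 : dist (bipyrConfig 2) (bipyrConfig 6) ^ 2 = 1 := by
    rw [hsq]
    simp only [bipyrCoord, Matrix.cons_val_zero, Matrix.cons_val_one, Matrix.cons_val_two, Matrix.cons_val,
      Matrix.head_cons, Matrix.tail_cons]
    linear_combination ((5 / 36 : ℝ) + (1 / 45 : ℝ) * Real.sqrt 5 * Real.sqrt 5) * h3 + ((1 / 15 : ℝ)) * h5
  have q34 : dist (bipyrConfig 3) (bipyrConfig 4) ^ 2 = (3 / 2 : ℝ) + (1 / 2 : ℝ) * Real.sqrt 5 := by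
    rw [hsq]
    simp only [bipyrCoord, Matrix.cons_val_zero, Matrix.cons_val_one, Matrix.cons_val_two, Matrix.cons_val,
      Matrix.head_cons, Matrix.tail_cons]
    linear_combination ((0 : ℝ)) * h3 + ((1 / 4 : ℝ)) * h5
  have q35 : dist (bipyrConfig 3) (bipyrConfig 5) ^ 2 = 1 := by
    rw [hsq]
    simp only [bipyrCoord, Matrix.cons_val_zero, Matrix.cons_val_one, Matrix.cons_val_two, Matrix.cons_val,
      Matrix.head_cons, Matrix.tail_cons]
    linear_combination ((25 / 144 : ℝ) + (-1 / 24 : ℝ) * Real.sqrt 5 + (1 / 144 : ℝ) * Real.sqrt 5 * Real.sqrt 5) * h3 + ((1 / 12 : ℝ)) * h5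
  have q36 : dist (bipyrConfig 3) (bipyrConfig 6) ^ 2 = 1 := by
    rw [hsq]
    simp only [bipyrCoord, Matrix.cons_val_zero, Matrix.cons_val_one, Matrix.cons_val_two, Matrix.cons_val,
      Matrix.head_cons, Matrix.tail_cons]
    linear_combination ((25 / 144 : ℝ) + (-1 / 24 : ℝ) * Real.sqrt 5 + (1 / 144 : ℝ) * Real.sqrt 5 * Real.sqrt 5) * h3 + ((1 / 12 : ℝ)) * h5
  have q45 : dist (bipyrConfig 4) (bipyrConfig 5) ^ 2 = 1 := by
    rw [hsq]
    simp only [bipyrCoord, Matrix.cons_val_zero, Matrix.cons_val_one, Matrix.cons_val_two, Matrix.cons_val,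
      Matrix.head_cons, Matrix.tail_cons]
    linear_combination ((25 / 144 : ℝ) + (-1 / 24 : ℝ) * Real.sqrt 5 + (1 / 144 : ℝ) * Real.sqrt 5 * Real.sqrt 5) * h3 + ((1 / 12 : ℝ)) * h5
  have q46 : dist (bipyrConfig 4) (bipyrConfig 6) ^ 2 = 1 := by
    rw [hsq]
    simp only [bipyrCoord, Matrix.cons_val_zero, Matrix.cons_val_one, Matrix.cons_val_two, Matrix.cons_val,
      Matrix.head_cons, Matrix.tail_cons]
    linear_combination ((25 / 144 : ℝ) + (-1 / 24 : ℝ) * Real.sqrt 5 + (1 / 144 : ℝ) * Real.sqrt 5 * Real.sqrt 5) * h3 + ((1 / 12 : ℝ)) * h5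
  have q56 : dist (bipyrConfig 5) (bipyrConfig 6) ^ 2 = (2 : ℝ) + (-2 / 5 : ℝ) * Real.sqrt 5 := by
    rw [hsq]
    simp only [bipyrCoord, Matrix.cons_val_zero, Matrix.cons_val_one, Matrix.cons_val_two, Matrix.cons_val,
      Matrix.head_cons, Matrix.tail_cons]
    linear_combination ((5 / 9 : ℝ) + (-2 / 15 : ℝ) * Real.sqrt 5 + (1 / 45 : ℝ) * Real.sqrt 5 * Real.sqrt 5) * h3 + ((1 / 15 : ℝ)) * h5
  have n01 : 1 < dist (bipyrConfig 0) (bipyrConfig 1) := by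
    have h : (1 : ℝ) ^ 2 < dist (bipyrConfig 0) (bipyrConfig 1) ^ 2 := by
      rw [one_pow, q01]
      linarith [h5n]
    exact lt_of_pow_lt_pow_left₀ 2 dist_nonneg h
  have c02 : dist (bipyrConfig 0) (bipyrConfig 2) = 1 :=
    (pow_eq_one_iff_of_nonneg dist_nonneg two_ne_zero).1 q02
  have c03 : dist (bipyrConfig 0) (bipyrConfig 3) = 1 :=
    (pow_eq_one_iff_of_nonneg dist_nonneg two_ne_zero).1 q03
  have n04 : 1 < dist (bipyrConfig 0) (bipyrConfig 4) := by
    have h : (1 : ℝ) ^ 2 < dist (bipyrConfig 0) (bipyrConfig 4) ^ 2 := by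
      rw [one_pow, q04]
      linarith [h5n]
    exact lt_of_pow_lt_pow_left₀ 2 dist_nonneg h
  have c05 : dist (bipyrConfig 0) (bipyrConfig 5) = 1 :=
    (pow_eq_one_iff_of_nonneg dist_nonneg two_ne_zero).1 q05
  have c06 : dist (bipyrConfig 0) (bipyrConfig 6) = 1 :=
    (pow_eq_one_iff_of_nonneg dist_nonneg two_ne_zero).1 q06
  have n12 : 1 < dist (bipyrConfig 1) (bipyrConfig 2) := by
    have h : (1 : ℝ) ^ 2 < dist (bipyrConfig 1) (bipyrConfig 2) ^ 2 := by
      rw [one_pow, q12]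
      linarith [h5n]
    exact lt_of_pow_lt_pow_left₀ 2 dist_nonneg h
  have c13 : dist (bipyrConfig 1) (bipyrConfig 3) = 1 :=
    (pow_eq_one_iff_of_nonneg dist_nonneg two_ne_zero).1 q13
  have c14 : dist (bipyrConfig 1) (bipyrConfig 4) = 1 :=
    (pow_eq_one_iff_of_nonneg dist_nonneg two_ne_zero).1 q14
  have c15 : dist (bipyrConfig 1) (bipyrConfig 5) = 1 :=
    (pow_eq_one_iff_of_nonneg dist_nonneg two_ne_zero).1 q15
  have c16 : dist (bipyrConfig 1) (bipyrConfig 6) = 1 :=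
    (pow_eq_one_iff_of_nonneg dist_nonneg two_ne_zero).1 q16
  have n23 : 1 < dist (bipyrConfig 2) (bipyrConfig 3) := by
    have h : (1 : ℝ) ^ 2 < dist (bipyrConfig 2) (bipyrConfig 3) ^ 2 := by
      rw [one_pow, q23]
      linarith [h5n]
    exact lt_of_pow_lt_pow_left₀ 2 dist_nonneg h
  have c24 : dist (bipyrConfig 2) (bipyrConfig 4) = 1 :=
    (pow_eq_one_iff_of_nonneg dist_nonneg two_ne_zero).1 q24
  have c25 : dist (bipyrConfig 2) (bipyrConfig 5) = 1 :=
    (pow_eq_one_iff_of_nonneg dist_nonneg two_ne_zero).1 q25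
  have c26 : dist (bipyrConfig 2) (bipyrConfig 6) = 1 :=
    (pow_eq_one_iff_of_nonneg dist_nonneg two_ne_zero).1 q26
  have n34 : 1 < dist (bipyrConfig 3) (bipyrConfig 4) := by
    have h : (1 : ℝ) ^ 2 < dist (bipyrConfig 3) (bipyrConfig 4) ^ 2 := by
      rw [one_pow, q34]
      linarith [h5n]
    exact lt_of_pow_lt_pow_left₀ 2 dist_nonneg h
  have c35 : dist (bipyrConfig 3) (bipyrConfig 5) = 1 :=
    (pow_eq_one_iff_of_nonneg dist_nonneg two_ne_zero).1 q35
  have c36 : dist (bipyrConfig 3) (bipyrConfig 6) = 1 :=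
    (pow_eq_one_iff_of_nonneg dist_nonneg two_ne_zero).1 q36
  have c45 : dist (bipyrConfig 4) (bipyrConfig 5) = 1 :=
    (pow_eq_one_iff_of_nonneg dist_nonneg two_ne_zero).1 q45
  have c46 : dist (bipyrConfig 4) (bipyrConfig 6) = 1 :=
    (pow_eq_one_iff_of_nonneg dist_nonneg two_ne_zero).1 q46
  have n56 : 1 < dist (bipyrConfig 5) (bipyrConfig 6) := by
    have h : (1 : ℝ) ^ 2 < dist (bipyrConfig 5) (bipyrConfig 6) ^ 2 := by
      rw [one_pow, q56]
      linarith [h5lt]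
    exact lt_of_pow_lt_pow_left₀ 2 dist_nonneg h
  have hiff : ∀ a b : Fin 7, a ≠ b →
      (dist (bipyrConfig a) (bipyrConfig b) = 1 ↔ (maskOf (bipyrEdges (0, 1, 2, 3, 4, 5, 6))).testBit (pidx a b) = true) := by
    intro a b hab
    fin_cases a <;> fin_cases b
    · exact absurd rfl hab
    · exact iff_of_false n01.ne' (by decide)
    · exact iff_of_true c02 (by decide)
    · exact iff_of_true c03 (by decide)
    · exact iff_of_false n04.ne' (by decide)
    · exact iff_of_true c05 (by decide)
    · exact iff_of_true c06 (by decide)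
    · exact iff_of_false (by rw [dist_comm]; exact n01.ne') (by decide)
    · exact absurd rfl hab
    · exact iff_of_false n12.ne' (by decide)
    · exact iff_of_true c13 (by decide)
    · exact iff_of_true c14 (by decide)
    · exact iff_of_true c15 (by decide)
    · exact iff_of_true c16 (by decide)
    · exact iff_of_true (by rw [dist_comm]; exact c02) (by decide)
    · exact iff_of_false (by rw [dist_comm]; exact n12.ne') (by decide)
    · exact absurd rfl hab
    · exact iff_of_false n23.ne' (by decide)
    · exact iff_of_true c24 (by decide)
    · exact iff_of_true c25 (by decide)
    · exact iff_of_true c26 (by decide)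
    · exact iff_of_true (by rw [dist_comm]; exact c03) (by decide)
    · exact iff_of_true (by rw [dist_comm]; exact c13) (by decide)
    · exact iff_of_false (by rw [dist_comm]; exact n23.ne') (by decide)
    · exact absurd rfl hab
    · exact iff_of_false n34.ne' (by decide)
    · exact iff_of_true c35 (by decide)
    · exact iff_of_true c36 (by decide)
    · exact iff_of_false (by rw [dist_comm]; exact n04.ne') (by decide)
    · exact iff_of_true (by rw [dist_comm]; exact c14) (by decide)
    · exact iff_of_true (by rw [dist_comm]; exact c24) (by decide)
    · exact iff_of_false (by rw [dist_comm]; exact n34.ne') (by decide)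
    · exact absurd rfl hab
    · exact iff_of_true c45 (by decide)
    · exact iff_of_true c46 (by decide)
    · exact iff_of_true (by rw [dist_comm]; exact c05) (by decide)
    · exact iff_of_true (by rw [dist_comm]; exact c15) (by decide)
    · exact iff_of_true (by rw [dist_comm]; exact c25) (by decide)
    · exact iff_of_true (by rw [dist_comm]; exact c35) (by decide)
    · exact iff_of_true (by rw [dist_comm]; exact c45) (by decide)
    · exact absurd rfl hab
    · exact iff_of_false n56.ne' (by decide)
    · exact iff_of_true (by rw [dist_comm]; exact c06) (by decide)
    · exact iff_of_true (by rw [dist_comm]; exact c16) (by decide)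
    · exact iff_of_true (by rw [dist_comm]; exact c26) (by decide)
    · exact iff_of_true (by rw [dist_comm]; exact c36) (by decide)
    · exact iff_of_true (by rw [dist_comm]; exact c46) (by decide)
    · exact iff_of_false (by rw [dist_comm]; exact n56.ne') (by decide)
    · exact absurd rfl hab
  refine ⟨bipyrConfig, ?_, ?_, hiff⟩
  · -- packing: every pair is at distance ≥ 1
    intro a b hab
    fin_cases a <;> fin_cases b
    · exact absurd rfl hab
    · exact n01.le
    · exact c02.ge
    · exact c03.ge
    · exact n04.le
    · exact c05.ge
    · exact c06.ge
    · exact (by rw [dist_comm]; exact n01.le)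
    · exact absurd rfl hab
    · exact n12.le
    · exact c13.ge
    · exact c14.ge
    · exact c15.ge
    · exact c16.ge
    · exact (by rw [dist_comm]; exact c02.ge)
    · exact (by rw [dist_comm]; exact n12.le)
    · exact absurd rfl hab
    · exact n23.le
    · exact c24.ge
    · exact c25.ge
    · exact c26.ge
    · exact (by rw [dist_comm]; exact c03.ge)
    · exact (by rw [dist_comm]; exact c13.ge)
    · exact (by rw [dist_comm]; exact n23.le)
    · exact absurd rfl hab
    · exact n34.le
    · exact c35.ge
    · exact c36.ge
    · exact (by rw [dist_comm]; exact n04.le)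
    · exact (by rw [dist_comm]; exact c14.ge)
    · exact (by rw [dist_comm]; exact c24.ge)
    · exact (by rw [dist_comm]; exact n34.le)
    · exact absurd rfl hab
    · exact c45.ge
    · exact c46.ge
    · exact (by rw [dist_comm]; exact c05.ge)
    · exact (by rw [dist_comm]; exact c15.ge)
    · exact (by rw [dist_comm]; exact c25.ge)
    · exact (by rw [dist_comm]; exact c35.ge)
    · exact (by rw [dist_comm]; exact c45.ge)
    · exact absurd rfl hab
    · exact n56.le
    · exact (by rw [dist_comm]; exact c06.ge)
    · exact (by rw [dist_comm]; exact c16.ge)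
    · exact (by rw [dist_comm]; exact c26.ge)
    · exact (by rw [dist_comm]; exact c36.ge)
    · exact (by rw [dist_comm]; exact c46.ge)
    · exact (by rw [dist_comm]; exact n56.le)
    · exact absurd rfl hab
  · -- exactly fifteen contacts
    unfold numContacts contactPairs
    rw [Finset.filter_congr (q := fun p : Fin 7 × Fin 7 =>
      p.1 < p.2 ∧ (maskOf (bipyrEdges (0, 1, 2, 3, 4, 5, 6))).testBit (pidx p.1 p.2) = true)
      (fun p _ => and_congr_right fun hlt => hiff p.1 p.2 (ne_of_lt hlt))]
    decide

end Summit.Ventures.Crystal3D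

end
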